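import Mathlib
import Summits.Ventures.FusionMHD.Models.CerfonFreidbergIterLikeQHalfMercPanel
import Summits.Ventures.FusionMHD.Models.CerfonFreidbergIterLikeQHalfGvalBoxes
import Summits.Ventures.FusionMHD.Models.CerfonFreidbergIterLikeQHalfResSound
import HarnessLib

/-!
# Ventures/FusionMHD — Models/CerfonFreidbergIterLikeQHalfResLink.lean: the two kernels `KV = volKernel = R s/D` and `KG = G·volKernel/R² = G s/(R D)` of GGJ's
# resistive index, their tube envelopes, the per-panel link data `ResLink`, and the PER-PANEL LINK THEOREM `res_panel_bracket`

HONEST FRAMING (LADDER-GRIDFUSION three columns; CF rung; rider «D_R at ψ_N = 1/2» of the booked row «F2.R2-CF-MERCIER-IMPLICIT», step (4)).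
* §1 kernels, factorised forms (`R, D ≠ 0`), identification with model-7's register functions `gWvA`, `gAGA` (`…QHalfResSound`) along the approximant;
* §2 envelopes `envV`, `envG` (generic field; `prod2_env`/`prod3_env` of `…QHalfMercEnvelope`, the `G`-factor bounded by `GHP k` (`…QHalfGvalBoxes`) and
  `M_G r` (`…QHalfGradBoxes`));
* §3 `ResLink` + `ResLink.check` (rational side conditions against ★ #117's records and model-7's `ResCert`);
* §4 **`res_panel_bracket`**: `Lo ≤ ∫_{Θ_j} K(θ, ρ θ) dθ ≤ Hi` for both kernels on the TRUE surface (generic `tube_link`).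
CERTIFIED: kernel.  VALIDATED: nothing used.  MODELLED: analytic Cerfon–Freidberg family; nothing about a device or stability.  Typer/prover: gridfusion-model-7 (g7),
2026-08-28.  Citations: Zheng 2015 §3.2 (3.42) [Zheng2015]; Jardin 2010 §5.3 (5.29) [Jardin2010].
-/

noncomputable section

open Set MeasureTheory intervalIntegral Filter Topology NonemptyInterval
open Literature.Analysis.ODE Literature.Analysis.ODE.FExpr
open Literature.Analysis.ValidatedNumerics Literature.Analysis.ValidatedNumerics.PolyMP
open Literature.Analysis.ValidatedNumerics.NumericsMP Literature.Analysis.ValidatedNumerics.ExpPoly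
open Literature.Analysis.ValidatedNumerics.ITaylor
open Literature.MathematicalPhysics.MHD Literature.MathematicalPhysics.MHD.CerfonFreidberg
open Summit.Ventures.FusionMHD.Models.PolarRay
open Summit.Ventures.FusionMHD.Models.CFIterLike.PolarPanel

set_option autoImplicit false

namespace Summit.Ventures.FusionMHD.Models.CFIterLike.QHalf

/-! ## §1 The two kernels -/

/-- The `V′`-kernel `volKernel = R s/D` of THE flux (`W = ∫ KV`). -/
def KV (θ s : ℝ) : ℝ := volKernel Xa Dfield θ s
/-- The kernel `G·volKernel/R² = G s/(R D)` (the `g`-free part of `bsqKernel g = g²·polarKernel + KG`; `A_G = ∫ KG`). -/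
def KG (θ s : ℝ) : ℝ := Gfield θ s * volKernel Xa Dfield θ s / (Xa + s * Real.cos θ) ^ 2

section forms
variable {θ s : ℝ}

/-- Factorised form of `KV`. -/
theorem KV_eq (hD : Dfield θ s ≠ 0) : KV θ s = ((Xa + s * Real.cos θ) * s) * (1 / Dfield θ s) := by
  unfold KV volKernel; field_simp
/-- Factorised form of `KG`. -/
theorem KG_eq (hR : Xa + s * Real.cos θ ≠ 0) (hD : Dfield θ s ≠ 0) :
    KG θ s = Gfield θ s * (s * (1 / (Xa + s * Real.cos θ))) * (1 / Dfield θ s) := by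
  unfold KG volKernel; field_simp

end forms

section regs
variable {t : ℝ}

/-- `gWvA = KV(πt, mA t)·π` where `X, D ≠ 0`. -/
theorem gWvA_eq (hX : QHalfMerc.XA t ≠ 0) (hD : DrA t ≠ 0) : QHalfRes.gWvA t = KV (Real.pi * t) (mA t) * Real.pi := by
  have hD' : Dfield (Real.pi * t) (mA t) ≠ 0 := hD
  have hX' : Xa + mA t * Real.cos (Real.pi * t) ≠ 0 := hX
  unfold QHalfRes.gWvA QHalfRes.WinvA QHalfMerc.XA KV volKernel DrA
  unfold Dfield at hD' ⊢
  field_simp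
/-- `gAGA = KG(πt, mA t)·π` where `X, D ≠ 0`. -/
theorem gAGA_eq (hX : QHalfMerc.XA t ≠ 0) (hD : DrA t ≠ 0) : QHalfRes.gAGA t = KG (Real.pi * t) (mA t) * Real.pi := by
  have hD' : Dfield (Real.pi * t) (mA t) ≠ 0 := hD
  have hX' : Xa + mA t * Real.cos (Real.pi * t) ≠ 0 := hX
  unfold QHalfRes.gAGA QHalfRes.WinvA QHalfMerc.XA QHalfMerc.GA KG volKernel DrA
  unfold Dfield at hD' ⊢
  field_simp

end regs

/-! ## §2 Envelopes -/

/-- Envelope formula of `KV = R s/D`. -/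
def envV {K : Type*} [Field K] (r M μ Xhi smax : K) : K := (r * smax + Xhi * r) * (1 / μ) + Xhi * smax * (M * r / μ ^ 2)

/-- Envelope formula of `KG = G·s/(R D)` (`|G| ≤ Gh`, `|ΔG| ≤ M_G r`). -/
def envG {K : Type*} [Field K] (r M MG Gh μ Xlo smax : K) : K :=
  (MG * r * (smax * (1 / Xlo)) + Gh * (r * (1 / Xlo) + smax * (r / Xlo ^ 2))) * (1 / μ) + Gh * (smax * (1 / Xlo)) * (M * r / μ ^ 2)

/-- Cast of `envV`. -/
theorem envV_cast (r M μ Xhi smax : ℚ) : ((envV r M μ Xhi smax : ℚ) : ℝ) = envV (r : ℝ) (M : ℝ) (μ : ℝ) (Xhi : ℝ) (smax : ℝ) := by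
  unfold envV; push_cast; ring
/-- Cast of `envG`. -/
theorem envG_cast (r M MG Gh μ Xlo smax : ℚ) :
    ((envG r M MG Gh μ Xlo smax : ℚ) : ℝ) = envG (r : ℝ) (M : ℝ) (MG : ℝ) (Gh : ℝ) (μ : ℝ) (Xlo : ℝ) (smax : ℝ) := by
  unfold envG; push_cast; ring

section env
variable {s m Rs Rm Ds Dm Gs Gm r M MG Gh μ ν Xlo Xhi smax : ℝ}

/-- **ENVELOPE OF `KV`.** [folklore] -/
theorem envV_bound (hμ : 0 < μ) (hXlo : 0 < Xlo) (hsm : |s - m| ≤ r) (hR : |Rs - Rm| ≤ r) (hD : |Ds - Dm| ≤ M * r) (hG : |Gs - Gm| ≤ MG * r)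
    (hDs : μ ≤ Ds ∧ Ds ≤ ν) (hDm : μ ≤ Dm ∧ Dm ≤ ν) (hRs : Xlo ≤ Rs ∧ Rs ≤ Xhi) (hRm : Xlo ≤ Rm ∧ Rm ≤ Xhi)
    (hs : 0 ≤ s ∧ s ≤ smax) (hm : 0 ≤ m ∧ m ≤ smax) (hGs : μ ^ 2 ≤ Gs) (hGm : μ ^ 2 ≤ Gm) :
    |(Rs * s) * (1 / Ds) - (Rm * m) * (1 / Dm)| ≤ envV r M μ Xhi smax := by
  obtain ⟨⟨bRs, bRm, dRsm⟩, ⟨bDs, bDm, dD⟩, -, -, -⟩ := factor_facts hμ hXlo hsm hR hD hG hDs hDm hRs hRm hs hm hGs hGm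
  unfold envV
  exact prod2_env bRm bDs dRsm dD

/-- **ENVELOPE OF `KG`.** [folklore] -/
theorem envG_bound (hμ : 0 < μ) (hXlo : 0 < Xlo) (hsm : |s - m| ≤ r) (hR : |Rs - Rm| ≤ r) (hD : |Ds - Dm| ≤ M * r) (hG : |Gs - Gm| ≤ MG * r)
    (hDs : μ ≤ Ds ∧ Ds ≤ ν) (hDm : μ ≤ Dm ∧ Dm ≤ ν) (hRs : Xlo ≤ Rs ∧ Rs ≤ Xhi) (hRm : Xlo ≤ Rm ∧ Rm ≤ Xhi)
    (hs : 0 ≤ s ∧ s ≤ smax) (hm : 0 ≤ m ∧ m ≤ smax) (hGs : μ ^ 2 ≤ Gs) (hGm : μ ^ 2 ≤ Gm) (hGmB : |Gm| ≤ Gh) :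
    |Gs * (s * (1 / Rs)) * (1 / Ds) - Gm * (m * (1 / Rm)) * (1 / Dm)| ≤ envG r M MG Gh μ Xlo smax := by
  obtain ⟨-, ⟨bDs, bDm, dD⟩, -, -, ⟨bQs, bQm, dQ⟩⟩ := factor_facts hμ hXlo hsm hR hD hG hDs hDm hRs hRm hs hm hGs hGm
  unfold envG
  exact prod3_env bQs bDs hGmB bQm hG dQ dD

end env

/-! ## §3 Per-panel resistive-link data and its rational side conditions -/

/-- Per-panel resistive-link constants: panel `j`, envelopes `EV EG`, brackets of `∫ KV`, `∫ KG`. -/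
structure ResLink where
  /-- panel index -/
  j : ℕ
  /-- envelope of `KV` -/
  EV : ℚ
  /-- envelope of `KG` -/
  EG : ℚ
  /-- bracket of `∫ KV` -/
  VLo : ℚ
  /-- … -/
  VHi : ℚ
  /-- bracket of `∫ KG` -/
  GLo : ℚ
  /-- … -/
  GHi : ℚ

/-- THE RATIONAL SIDE CONDITIONS of the resistive link on panel `j`. -/
def ResLink.check (rl : ResLink) (ℓ : LinkData) (d : PanelCert) (b : BoxData) (rc : QHalfRes.ResCert) : Bool :=
  let C := gBox d.j
  let μ : ℚ := (d.dlo : ℚ) / tmS - b.M * ℓ.r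
  let Xlo : ℚ := XaLoQ - b.smax
  let Xhi : ℚ := XaHiQ + b.smax
  decide (rc.j = d.j) && decide (rl.j = d.j) && decide (d.j < 32)
  && decide (C.1 ≤ piLoQ * panelLeft hw d.j) && decide (piHiQ * panelLeft hw (d.j + 1) ≤ C.2.1)
  && decide (0 < C.2.2.1) && decide (C.2.2.2 < 1)
  && decide (C.2.2.1 ≤ (d.mlo : ℚ) / tmS - ℓ.r) && decide ((d.mhi : ℚ) / tmS + ℓ.r ≤ C.2.2.2)
  && decide (0 < μ) && decide (0 < Xlo) && decide (0 ≤ rl.EV) && decide (0 ≤ rl.EG)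
  && decide (envV ℓ.r b.M μ Xhi b.smax ≤ rl.EV) && decide (envG ℓ.r b.M (MGP d.j) (GHP d.j) μ Xlo b.smax ≤ rl.EG)
  && decide (rl.VLo ≤ (rc.wlo : ℚ) / tmS - rl.EV * (piHiQ / 32)) && decide ((rc.whi : ℚ) / tmS + rl.EV * (piHiQ / 32) ≤ rl.VHi)
  && decide (rl.GLo ≤ (rc.glo : ℚ) / tmS - rl.EG * (piHiQ / 32)) && decide ((rc.ghi : ℚ) / tmS + rl.EG * (piHiQ / 32) ≤ rl.GHi)

/-! ## §4 The per-panel resistive link theorem -/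

section panel

variable {d : PanelCert} {b : BoxData} {ℓ : LinkData} {rc : QHalfRes.ResCert} {rl : ResLink}

set_option maxHeartbeats 8000000 in
/-- **THE PER-PANEL RESISTIVE LINK**: brackets of `∫_{Θ_j} KV(θ, ρ θ)` and `∫_{Θ_j} KG(θ, ρ θ)` on the TRUE surface, with integrability. -/
theorem res_panel_bracket (hd : d.ok = true) (hb : b.ok = true) (hℓ : ℓ.check d b = true) (hlev : levelCheck ℓ d b = true)
    (hrc : rc.ok = true) (hrl : rl.check ℓ d b rc = true) :
    Bracket KV (Real.pi * ((panelLeft hw d.j : ℚ) : ℝ)) (Real.pi * ((panelLeft hw (d.j + 1) : ℚ) : ℝ)) ((rl.VLo : ℚ) : ℝ) ((rl.VHi : ℚ) : ℝ)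
    ∧ Bracket KG (Real.pi * ((panelLeft hw d.j : ℚ) : ℝ)) (Real.pi * ((panelLeft hw (d.j + 1) : ℚ) : ℝ)) ((rl.GLo : ℚ) : ℝ) ((rl.GHi : ℚ) : ℝ) := by
  set a : ℝ := Real.pi * ((panelLeft hw d.j : ℚ) : ℝ) with ha_def
  set a' : ℝ := Real.pi * ((panelLeft hw (d.j + 1) : ℚ) : ℝ) with ha'_def
  have P := levelPanel_of_check hd hb hℓ hlev
  have SF := stripFacts_of_check hd hb hℓ
  simp only [ResLink.check, Bool.and_eq_true, decide_eq_true_eq] at hrl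
  obtain ⟨⟨⟨⟨⟨⟨⟨⟨⟨⟨⟨⟨⟨⟨⟨⟨⟨⟨cmj, -⟩, cj32⟩, cCtlo⟩, cCthi⟩, cCslo0⟩, cCshi1⟩, cCslo⟩, cCshi⟩, cμ⟩, cXlo⟩, cEV0⟩, cEG0⟩, cEV⟩, cEG⟩, cVLo⟩, cVHi⟩, cGLo⟩, cGHi⟩ := hrl
  have hboxG := gsokP cj32
  have hboxV := gvokP cj32
  have hS : (0 : ℝ) < ((tmS : ℕ) : ℝ) := by exact_mod_cast tmS_pos
  have hpi := Real.pi_pos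
  have hpiLo : ((piLoQ : ℚ) : ℝ) < Real.pi := by have := Real.pi_gt_d20; norm_num [piLoQ] at this ⊢; exact this
  have hpiHi : Real.pi < ((piHiQ : ℚ) : ℝ) := by have := Real.pi_lt_d20; norm_num [piHiQ] at this ⊢; exact this
  have hXaLo : ((XaLoQ : ℚ) : ℝ) ≤ Xa := by have := Xa_bounds.1; norm_num [XaLoQ] at this ⊢; exact this
  have hXaHi : Xa ≤ ((XaHiQ : ℚ) : ℝ) := by have := Xa_bounds.2; norm_num [XaHiQ] at this ⊢; exact this
  -- θ-range and s-range of the per-panel box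
  have hpl0 : (0 : ℚ) ≤ panelLeft hw d.j := by unfold panelLeft hw; positivity
  have hθC : ∀ θ ∈ Icc a a', (((gBox d.j).1 : ℚ) : ℝ) ≤ θ ∧ θ ≤ (((gBox d.j).2.1 : ℚ) : ℝ) := by
    intro θ hθ
    have h1 : (((gBox d.j).1 : ℚ) : ℝ) ≤ a := by
      have : (((gBox d.j).1 : ℚ) : ℝ) ≤ ((piLoQ : ℚ) : ℝ) * ((panelLeft hw d.j : ℚ) : ℝ) := by exact_mod_cast cCtlo
      have h2 : ((piLoQ : ℚ) : ℝ) * ((panelLeft hw d.j : ℚ) : ℝ) ≤ a := mul_le_mul_of_nonneg_right hpiLo.le (by exact_mod_cast hpl0)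
      linarith
    have h2 : a' ≤ (((gBox d.j).2.1 : ℚ) : ℝ) := by
      have : ((piHiQ : ℚ) : ℝ) * ((panelLeft hw (d.j + 1) : ℚ) : ℝ) ≤ (((gBox d.j).2.1 : ℚ) : ℝ) := by exact_mod_cast cCthi
      have hpl1 : (0 : ℝ) ≤ ((panelLeft hw (d.j + 1) : ℚ) : ℝ) := by
        exact_mod_cast (show (0 : ℚ) ≤ panelLeft hw (d.j + 1) by unfold panelLeft hw; positivity)
      have h3 : a' ≤ ((piHiQ : ℚ) : ℝ) * ((panelLeft hw (d.j + 1) : ℚ) : ℝ) := mul_le_mul_of_nonneg_right hpiHi.le hpl1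
      linarith
    exact ⟨h1.trans hθ.1, hθ.2.trans h2⟩
  have htubeC : ∀ θ ∈ Icc a a', ∀ s ∈ Icc (mθ θ - ((ℓ.r : ℚ) : ℝ)) (mθ θ + ((ℓ.r : ℚ) : ℝ)),
      s ∈ Icc (((gBox d.j).2.2.1 : ℚ) : ℝ) (((gBox d.j).2.2.2 : ℚ) : ℝ) := by
    intro θ hθ s hs
    have c1 : (((gBox d.j).2.2.1 : ℚ) : ℝ) ≤ (d.mlo : ℝ) / ((tmS : ℕ) : ℝ) - ((ℓ.r : ℚ) : ℝ) := by
      have := (show (((gBox d.j).2.2.1 : ℚ) : ℝ) ≤ ((((d.mlo : ℚ) / tmS - ℓ.r : ℚ)) : ℝ) by exact_mod_cast cCslo); push_cast at this; exact this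
    have c2 : (d.mhi : ℝ) / ((tmS : ℕ) : ℝ) + ((ℓ.r : ℚ) : ℝ) ≤ (((gBox d.j).2.2.2 : ℚ) : ℝ) := by
      have := (show ((((d.mhi : ℚ) / tmS + ℓ.r : ℚ)) : ℝ) ≤ (((gBox d.j).2.2.2 : ℚ) : ℝ) by exact_mod_cast cCshi); push_cast at this; exact this
    obtain ⟨h1, h2⟩ := SF.m_mem θ hθ
    exact ⟨by linarith [hs.1], by linarith [hs.2]⟩
  have hCslo0 : (0 : ℝ) < (((gBox d.j).2.2.1 : ℚ) : ℝ) := by exact_mod_cast cCslo0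
  have hCshi1 : (((gBox d.j).2.2.2 : ℚ) : ℝ) < 1 := by exact_mod_cast cCshi1
  have hmtube : ∀ θ ∈ Icc a a', mθ θ ∈ Icc (mθ θ - ((ℓ.r : ℚ) : ℝ)) (mθ θ + ((ℓ.r : ℚ) : ℝ)) :=
    fun θ _ => ⟨by linarith [SF.hr], by linarith [SF.hr]⟩
  have hMG0 : (0 : ℝ) ≤ ((MGP d.j : ℚ) : ℝ) := by
    have h := Gs_abs_of_gsok1 hboxG (hθC a ⟨le_rfl, P.hab⟩) (htubeC a ⟨le_rfl, P.hab⟩ _ (hmtube a ⟨le_rfl, P.hab⟩))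
    exact (abs_nonneg _).trans h
  have hGlip : ∀ θ ∈ Icc a a', ∀ s ∈ Icc (mθ θ - ((ℓ.r : ℚ) : ℝ)) (mθ θ + ((ℓ.r : ℚ) : ℝ)),
      |Gfield θ s - Gfield θ (mθ θ)| ≤ ((MGP d.j : ℚ) : ℝ) * ((ℓ.r : ℚ) : ℝ) := by
    intro θ hθ s hs
    have h := G_lipschitz_of_Gs (θ := θ) hCslo0 hCshi1 (fun x hx => Gs_abs_of_gsok1 hboxG (hθC θ hθ) hx) (htubeC θ hθ s hs) (htubeC θ hθ _ (hmtube θ hθ))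
    have hsm : |s - mθ θ| ≤ ((ℓ.r : ℚ) : ℝ) := abs_le.2 ⟨by linarith [hs.1], by linarith [hs.2]⟩
    exact h.trans (mul_le_mul_of_nonneg_left hsm hMG0)
  have hGbd : ∀ θ ∈ Icc a a', ∀ s ∈ Icc (mθ θ - ((ℓ.r : ℚ) : ℝ)) (mθ θ + ((ℓ.r : ℚ) : ℝ)), |Gfield θ s| ≤ ((GHP d.j : ℚ) : ℝ) := by
    intro θ hθ s hs
    have hsC := htubeC θ hθ s hs
    have hs0 : s ≠ 0 := (hCslo0.trans_le hsC.1).ne'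
    rw [abs_of_nonneg ((sq_nonneg _).trans (Dfield_sq_le_Gfield θ s))]
    exact G_le_of_gvok1 hboxV hs0 (hθC θ hθ) hsC
  -- real constants
  set μ : ℝ := (d.dlo : ℝ) / ((tmS : ℕ) : ℝ) - ((b.M : ℚ) : ℝ) * ((ℓ.r : ℚ) : ℝ) with hμ_def
  set ν : ℝ := (d.dhi : ℝ) / ((tmS : ℕ) : ℝ) + ((b.M : ℚ) : ℝ) * ((ℓ.r : ℚ) : ℝ) with hν_def
  set Xlo : ℝ := ((XaLoQ : ℚ) : ℝ) - ((b.smax : ℚ) : ℝ) with hXlo_def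
  set Xhi : ℝ := ((XaHiQ : ℚ) : ℝ) + ((b.smax : ℚ) : ℝ) with hXhi_def
  have hμ0 : 0 < μ := by
    have := (show ((0 : ℚ) : ℝ) < ((((d.dlo : ℚ) / tmS - b.M * ℓ.r : ℚ)) : ℝ) by exact_mod_cast cμ); push_cast at this; exact this
  have hXlo0 : 0 < Xlo := by
    have := (show ((0 : ℚ) : ℝ) < ((XaLoQ - b.smax : ℚ) : ℝ) by exact_mod_cast cXlo); push_cast at this; exact this
  have hEV0 : (0 : ℝ) ≤ ((rl.EV : ℚ) : ℝ) := by exact_mod_cast cEV0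
  have hEG0 : (0 : ℝ) ≤ ((rl.EG : ℚ) : ℝ) := by exact_mod_cast cEG0
  have hEV : envV ((ℓ.r : ℚ) : ℝ) ((b.M : ℚ) : ℝ) μ Xhi ((b.smax : ℚ) : ℝ) ≤ ((rl.EV : ℚ) : ℝ) := by
    have h := (show ((envV ℓ.r b.M ((d.dlo : ℚ) / tmS - b.M * ℓ.r) (XaHiQ + b.smax) b.smax : ℚ) : ℝ) ≤ ((rl.EV : ℚ) : ℝ) by exact_mod_cast cEV)
    rw [envV_cast] at h; push_cast at h; exact h
  have hEG : envG ((ℓ.r : ℚ) : ℝ) ((b.M : ℚ) : ℝ) ((MGP d.j : ℚ) : ℝ) ((GHP d.j : ℚ) : ℝ) μ Xlo ((b.smax : ℚ) : ℝ) ≤ ((rl.EG : ℚ) : ℝ) := by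
    have h := (show ((envG ℓ.r b.M (MGP d.j) (GHP d.j) ((d.dlo : ℚ) / tmS - b.M * ℓ.r) (XaLoQ - b.smax) b.smax : ℚ) : ℝ) ≤ ((rl.EG : ℚ) : ℝ) by exact_mod_cast cEG)
    rw [envG_cast] at h; push_cast at h; exact h
  -- common per-point facts
  have common : ∀ θ ∈ Icc a a', ∀ s ∈ Icc (mθ θ - ((ℓ.r : ℚ) : ℝ)) (mθ θ + ((ℓ.r : ℚ) : ℝ)),
      |s - mθ θ| ≤ ((ℓ.r : ℚ) : ℝ)
      ∧ |(Xa + s * Real.cos θ) - (Xa + mθ θ * Real.cos θ)| ≤ ((ℓ.r : ℚ) : ℝ)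
      ∧ |Dfield θ s - Dfield θ (mθ θ)| ≤ ((b.M : ℚ) : ℝ) * ((ℓ.r : ℚ) : ℝ)
      ∧ (μ ≤ Dfield θ s ∧ Dfield θ s ≤ ν) ∧ (μ ≤ Dfield θ (mθ θ) ∧ Dfield θ (mθ θ) ≤ ν)
      ∧ (Xlo ≤ Xa + s * Real.cos θ ∧ Xa + s * Real.cos θ ≤ Xhi) ∧ (Xlo ≤ Xa + mθ θ * Real.cos θ ∧ Xa + mθ θ * Real.cos θ ≤ Xhi)
      ∧ (0 ≤ s ∧ s ≤ ((b.smax : ℚ) : ℝ)) ∧ (0 ≤ mθ θ ∧ mθ θ ≤ ((b.smax : ℚ) : ℝ))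
      ∧ μ ^ 2 ≤ Gfield θ s ∧ μ ^ 2 ≤ Gfield θ (mθ θ) := by
    intro θ hθ s hs
    have hsS := SF.tube_sub hθ hs
    have hmS := SF.m_sub hθ
    obtain ⟨hDd, hDlo, hDhi⟩ := SF.tube_D hθ hs
    obtain ⟨hDm1, hDm2⟩ := SF.D_m θ hθ
    have hMr : 0 ≤ ((b.M : ℚ) : ℝ) * ((ℓ.r : ℚ) : ℝ) := mul_nonneg SF.hM SF.hr.le
    have hRs := SF.strip_R (θ := θ) hsS
    have hRm := SF.strip_R (θ := θ) hmS
    have hsm : |s - mθ θ| ≤ ((ℓ.r : ℚ) : ℝ) := abs_le.2 ⟨by linarith [hs.1], by linarith [hs.2]⟩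
    have hμs : μ ≤ Dfield θ s := hDlo
    have hμm : μ ≤ Dfield θ (mθ θ) := by linarith
    exact ⟨hsm, (StripFacts.R_sub_abs θ s (mθ θ)).trans hsm, hDd, ⟨hDlo, hDhi⟩, ⟨hμm, by linarith⟩,
      ⟨by linarith [hRs.1], by linarith [hRs.2]⟩, ⟨by linarith [hRm.1], by linarith [hRm.2]⟩,
      ⟨SF.hsA.le.trans hsS.1, hsS.2⟩, ⟨SF.hsA.le.trans hmS.1, hmS.2⟩,
      (pow_le_pow_left₀ hμ0.le hμs 2).trans (Dfield_sq_le_Gfield θ s), (pow_le_pow_left₀ hμ0.le hμm 2).trans (Dfield_sq_le_Gfield θ (mθ θ))⟩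
  -- envelopes on the tube
  have hEVt : ∀ θ ∈ Icc a a', ∀ s ∈ Icc (mθ θ - ((ℓ.r : ℚ) : ℝ)) (mθ θ + ((ℓ.r : ℚ) : ℝ)), |KV θ s - KV θ (mθ θ)| ≤ ((rl.EV : ℚ) : ℝ) := by
    intro θ hθ s hs
    obtain ⟨hsm, hR, hDd, hDs, hDm, hRs, hRm, hs01, hm01, hGs, hGm⟩ := common θ hθ s hs
    have hDs0 : Dfield θ s ≠ 0 := (hμ0.trans_le hDs.1).ne'
    have hDm0 : Dfield θ (mθ θ) ≠ 0 := (hμ0.trans_le hDm.1).ne'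
    rw [KV_eq hDs0, KV_eq hDm0]
    exact (envV_bound hμ0 hXlo0 hsm hR hDd (hGlip θ hθ s hs) hDs hDm hRs hRm hs01 hm01 hGs hGm).trans hEV
  have hEGt : ∀ θ ∈ Icc a a', ∀ s ∈ Icc (mθ θ - ((ℓ.r : ℚ) : ℝ)) (mθ θ + ((ℓ.r : ℚ) : ℝ)), |KG θ s - KG θ (mθ θ)| ≤ ((rl.EG : ℚ) : ℝ) := by
    intro θ hθ s hs
    obtain ⟨hsm, hR, hDd, hDs, hDm, hRs, hRm, hs01, hm01, hGs, hGm⟩ := common θ hθ s hs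
    have hDs0 : Dfield θ s ≠ 0 := (hμ0.trans_le hDs.1).ne'
    have hDm0 : Dfield θ (mθ θ) ≠ 0 := (hμ0.trans_le hDm.1).ne'
    have hXs0 : Xa + s * Real.cos θ ≠ 0 := (hXlo0.trans_le hRs.1).ne'
    have hXm0 : Xa + mθ θ * Real.cos θ ≠ 0 := (hXlo0.trans_le hRm.1).ne'
    rw [KG_eq hXs0 hDs0, KG_eq hXm0 hDm0]
    exact (envG_bound hμ0 hXlo0 hsm hR hDd (hGlip θ hθ s hs) hDs hDm hRs hRm hs01 hm01 hGs hGm (hGbd θ hθ _ (hmtube θ hθ))).trans hEG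
  -- continuity of the kernels on the box
  set Bx := Icc a a' ×ˢ Icc ((b.sA : ℚ) : ℝ) ((b.smax : ℚ) : ℝ) with hBx
  have hD0 : ∀ p ∈ Bx, Dfield p.1 p.2 ≠ 0 := fun p hp => (P.slopePos p.1 hp.1 p.2 hp.2).ne'
  have hR0 : ∀ p ∈ Bx, Xa + p.2 * Real.cos p.1 ≠ 0 := fun p hp => (SF.strip_X_pos (θ := p.1) hp.2).ne'
  have hGc : ContinuousOn (fun p : ℝ × ℝ => Gfield p.1 p.2) Bx := continuousOn_Gfield_box' SF.hsA SF.hsmax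
  have hRc : ContinuousOn (fun p : ℝ × ℝ => (Xa + p.2 * Real.cos p.1) ^ 2) Bx := by fun_prop
  have hKVc : ContinuousOn (fun p : ℝ × ℝ => KV p.1 p.2) Bx := continuousOn_volKernel P.slopeCont hD0
  have hKGc : ContinuousOn (fun p : ℝ × ℝ => KG p.1 p.2) Bx :=
    (hGc.mul (continuousOn_volKernel P.slopeCont hD0)).div hRc fun p hp => pow_ne_zero 2 (hR0 p hp)
  -- the certificate segments
  have hsc' := QHalfRes.sound_of_ok hrc
  rw [cmj] at hsc'
  obtain ⟨hsG, hsV⟩ := hsc'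
  have tfacts : ∀ t ∈ Icc ((panelLeft hw d.j : ℚ) : ℝ) ((panelLeft hw (d.j + 1) : ℚ) : ℝ),
      Real.pi * t ∈ Icc a a' ∧ mθ (Real.pi * t) = mA t ∧ QHalfMerc.XA t ≠ 0 ∧ DrA t ≠ 0 := by
    intro t ht
    have hθ : Real.pi * t ∈ Icc a a' := ⟨mul_le_mul_of_nonneg_left ht.1 hpi.le, mul_le_mul_of_nonneg_left ht.2 hpi.le⟩
    have hmt : mθ (Real.pi * t) = mA t := by unfold mθ; rw [mul_div_cancel_left₀ t hpi.ne']
    obtain ⟨-, -, -, -, hDm, -, hRm, -, -, -, -⟩ := common _ hθ _ (hmtube _ hθ)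
    rw [hmt] at hDm hRm
    refine ⟨hθ, hmt, ?_, ?_⟩
    · show Xa + mA t * Real.cos (Real.pi * t) ≠ 0; exact (hXlo0.trans_le hRm.1).ne'
    · show Dfield (Real.pi * t) (mA t) ≠ 0; exact (hμ0.trans_le hDm.1).ne'
  have hgV : ∀ t ∈ Icc ((panelLeft hw d.j : ℚ) : ℝ) ((panelLeft hw (d.j + 1) : ℚ) : ℝ), QHalfRes.gWvA t = KV (Real.pi * t) (mθ (Real.pi * t)) * Real.pi := by
    intro t ht; obtain ⟨-, hmt, hX, hD⟩ := tfacts t ht; rw [hmt]; exact gWvA_eq hX hD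
  have hgG : ∀ t ∈ Icc ((panelLeft hw d.j : ℚ) : ℝ) ((panelLeft hw (d.j + 1) : ℚ) : ℝ), QHalfRes.gAGA t = KG (Real.pi * t) (mθ (Real.pi * t)) * Real.pi := by
    intro t ht; obtain ⟨-, hmt, hX, hD⟩ := tfacts t ht; rw [hmt]; exact gAGA_eq hX hD
  have cV1 : ((rl.VLo : ℚ) : ℝ) ≤ (rc.wlo : ℝ) / ((tmS : ℕ) : ℝ) - ((rl.EV : ℚ) : ℝ) * (((piHiQ : ℚ) : ℝ) / 32) := by
    have := (show ((rl.VLo : ℚ) : ℝ) ≤ ((((rc.wlo : ℚ) / tmS - rl.EV * (piHiQ / 32) : ℚ)) : ℝ) by exact_mod_cast cVLo); push_cast at this; exact this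
  have cV2 : (rc.whi : ℝ) / ((tmS : ℕ) : ℝ) + ((rl.EV : ℚ) : ℝ) * (((piHiQ : ℚ) : ℝ) / 32) ≤ ((rl.VHi : ℚ) : ℝ) := by
    have := (show ((((rc.whi : ℚ) / tmS + rl.EV * (piHiQ / 32) : ℚ)) : ℝ) ≤ ((rl.VHi : ℚ) : ℝ) by exact_mod_cast cVHi); push_cast at this; exact this
  have cG1 : ((rl.GLo : ℚ) : ℝ) ≤ (rc.glo : ℝ) / ((tmS : ℕ) : ℝ) - ((rl.EG : ℚ) : ℝ) * (((piHiQ : ℚ) : ℝ) / 32) := by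
    have := (show ((rl.GLo : ℚ) : ℝ) ≤ ((((rc.glo : ℚ) / tmS - rl.EG * (piHiQ / 32) : ℚ)) : ℝ) by exact_mod_cast cGLo); push_cast at this; exact this
  have cG2 : (rc.ghi : ℝ) / ((tmS : ℕ) : ℝ) + ((rl.EG : ℚ) : ℝ) * (((piHiQ : ℚ) : ℝ) / 32) ≤ ((rl.GHi : ℚ) : ℝ) := by
    have := (show ((((rc.ghi : ℚ) / tmS + rl.EG * (piHiQ / 32) : ℚ)) : ℝ) ≤ ((rl.GHi : ℚ) : ℝ) by exact_mod_cast cGHi); push_cast at this; exact this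
  exact ⟨tube_link P SF ha_def ha'_def hKVc hsV hgV hEV0 hEVt cV1 cV2, tube_link P SF ha_def ha'_def hKGc hsG hgG hEG0 hEGt cG1 cG2⟩

end panel

end Summit.Ventures.FusionMHD.Models.CFIterLike.QHalf

end
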